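import Summits.NavierStokesRegularity.FluidComputer.RowScaleSound
import HarnessLib

/-!
# Soundness of the closure row, the phase budget and the forcing table of the row check
# (`pub-fluidc-bp3/R1-DESIGN.md` §9.2 / §9.4, layer B of `structure Row`)

HONEST FRAMING (cell `pub-fluidc`, blueprint seat bp3, gen 20): low prior, high value-of-information
experiment on Tao's machine paradigm; NOT a claim that NS blows up. Real / integer bookkeeping only.

The three purely arithmetical tests of the row check besides the chains (`RowChainSound`):
* the CLOSURE row `closOK` (`Σ_i |G|_ki W̄_i + Σ_l |R|_kl Ē_l < Ē_k` for `k ≠ p`, `Ē_p = 0`) gives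
  `Cert.hEbar` for the real views `GmR = |G|/2^P`, `RmR = |R|/2^P`, `EbarR`, `WbarR` (and `hEbar0`);
* the PHASE step `phase` (`D_p = Σ|J_pb|Ē_b + FQ_p + δ_p + DB_p < |Φ|_lo`,
  `ρ = ⌈D_p/(|Φ|_lo − D_p)⌉`) gives `Cert.hDp` and `Cert.hρ` for `DpR`, `PhiloR`, `rhoR` (the map
`x ↦ x/(Φ−x)` is monotone);
* the FORCING table `phi` gives `Cert.hφ`:
  `Σ_b CF_ib Ē_b + (1+ρ) Σ_b |AP̃|_ib (FQ_b + δ_b + DB_b) ≤ φ_i`.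
Every integer stands for its value `/2^P` (`toR`), every product was rounded up (`toR_mul_le`).
That the integer tables `|G|`, `|R|`, `|J_p·|`, `CF`, `|AP̃|` bound the real matrices on the row is
the ENCLOSURE half (successor files); here they are just the integers the kernel wrote.

[cite: Tao2016AveragedNS, §5.5 Thm 5.3 (5.5)]
-/

namespace Summit.NavierStokesRegularity.FluidComputer

open Literature.Analysis.FluidPDE.FluidComputer
open Literature.Analysis.ValidatedNumerics.Numerics (cdiv div_le_cdiv le_cdiv_mul_real)

namespace RowCheck

open DIVec ChainField Finset Real

namespace RowData

variable (r : RowData)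

/-! ### Real views -/

/-- `Ē`. [folklore] -/
noncomputable def EbarR (b : Fin 9) : ℝ := r.toR (r.Eb b)
/-- `|G|` (slot columns). [folklore] -/
noncomputable def GmR (a : Fin 9) (i : Fin 8) : ℝ := r.toR (r.Gabs a i)
/-- `|R|` over the row. [folklore] -/
noncomputable def RmR (a b : Fin 9) : ℝ := r.toR ((r.RU r.pre).at a b).mag
/-- the Jacobian enclosure at `x̂(U)` used by the phase step. [folklore] -/
def JIU : Tab DI 9 9 := Tab.mk' (JmatI r.P r.cU r.cD (r.XIon r.U).get)
/-- `|J_{p b}|` over the row. [folklore] -/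
noncomputable def JpmR (b : Fin 9) : ℝ := r.toR (r.JIU.at r.p b).mag
/-- `FQ`. [folklore] -/
noncomputable def FQR (b : Fin 9) : ℝ := r.toR (r.FQ.get b)
/-- `δ`. [folklore] -/
noncomputable def δR (b : Fin 9) : ℝ := r.toR (r.DEL b)
/-- `DB`. [folklore] -/
noncomputable def DBR (b : Fin 9) : ℝ := r.toR (r.DB.get b)
/-- `|Φ|_lo`. [folklore] -/
noncomputable def PhiloR : ℝ := r.toR r.ph'.PhiAbsLo
/-- `D_p` (the REAL combination, as in `RowModel.Dp`). [folklore] -/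
noncomputable def DpR : ℝ := ∑ b, r.JpmR b * r.EbarR b + r.FQR r.p + r.δR r.p + r.DBR r.p
/-- `ρ`. [folklore] -/
noncomputable def rhoR : ℝ := r.toR r.ph'.rho
/-- forcing coefficients, `e`-part (slot rows). [folklore] -/
noncomputable def CFR (i : Fin 8) (b : Fin 9) : ℝ := r.toR (r.sb'.CF.at i.succ b)
/-- `|AP̃|` (slot rows). [folklore] -/
noncomputable def APmR (i : Fin 8) (b : Fin 9) : ℝ := r.toR (r.sb'.APTM.at i.succ b)

variable {r}

/-- `toR` of a sum. [folklore] -/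
theorem toR_sum {α : Type} (s : Finset α) (f : α → ℤ) :
    r.toR (∑ a ∈ s, f a) = ∑ a ∈ s, r.toR (f a) := by
  simp [toR, Finset.sum_div]

/-- `toR 0 = 0`. [folklore] -/
@[simp] theorem toR_zero : r.toR 0 = 0 := by simp [toR]

/-- `toR 2^P = 1`. [folklore] -/
@[simp] theorem toR_one : r.toR (one r.P) = 1 := by
  simp [toR, one]

/-! ### The closure row -/

/-- What `closOK` says. [folklore] -/
theorem closOK_iff : r.rowCheck.closOK = true ↔ r.Eb r.p = 0 ∧ ∀ k : Fin 9, k ≠ r.p →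
    (sumZ 8 fun j => cdiv (r.Gabs k j * r.Wbar j.succ) (one r.P)) +
      (sumZ 9 fun l => cdiv (((r.RU r.pre).at k l).mag * r.Eb l) (one r.P)) < r.Eb k := by
  rw [rowCheck_eq]
  simp only [closOK, Bool.and_eq_true, decide_eq_true_eq]

/-- `Ē_p = 0`. [folklore] -/
theorem EbarR_p (hc : r.rowCheck.closOK = true) : r.EbarR r.p = 0 := by
  rw [EbarR, (closOK_iff.mp hc).1, toR_zero]

/-- `0 ≤ Ē` (`Cert.hEbar0`). [folklore] -/
theorem EbarR_nonneg (hn : r.signsOK = true) (b : Fin 9) : 0 ≤ r.EbarR b :=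
  toR_nonneg ((nnOK_iff.mp hn).2.1 b)

/-- `Cert.hEbar`: the strict closure row off the phase. [folklore] -/
theorem closure_sound (hc : r.rowCheck.closOK = true) (k : Fin 9) (hk : k ≠ r.p) :
    ∑ i, r.GmR k i * r.WbarR i + ∑ b, r.RmR k b * r.EbarR b < r.EbarR k := by
  have h := (closOK_iff.mp hc).2 k hk
  rw [sumZ_eq, sumZ_eq] at h
  have h' := toR_lt (r := r) h
  rw [toR_add, toR_sum, toR_sum] at h'
  refine lt_of_le_of_lt (add_le_add (sum_le_sum fun i _ => ?_) (sum_le_sum fun b _ => ?_)) h'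
  · exact toR_mul_le _ _
  · exact toR_mul_le _ _

/-! ### The phase budget -/

/-- The components of the phase step. [folklore] -/
theorem ph'_PhiAbsLo :
    r.ph'.PhiAbsLo = min |((r.DXIon r.U).get r.p).lo| |((r.DXIon r.U).get r.p).hi| := rfl

/-- The components of the phase step. [folklore] -/
theorem ph'_Dp : r.ph'.Dp = (sumZ 9 fun k => cdiv ((r.JIU.at r.p k).mag * r.Eb k) (one r.P)) +
    r.FQ.get r.p + r.DEL r.p + r.DB.get r.p := rfl

/-- The components of the phase step. [folklore] -/
theorem ph'_rho : r.ph'.rho = cdiv (r.ph'.Dp * one r.P) (r.ph'.PhiAbsLo - r.ph'.Dp) := rfl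

/-- The components of the phase step. [folklore] -/
theorem ph'_ok :
    r.ph'.ok = (signDef ((r.DXIon r.U).get r.p) && decide (r.ph'.Dp < r.ph'.PhiAbsLo)) := rfl

/-- `0 ≤ |Φ|_lo`. [folklore] -/
theorem PhiAbsLo_nonneg : 0 ≤ r.ph'.PhiAbsLo := by
  rw [ph'_PhiAbsLo]; exact le_min (abs_nonneg _) (abs_nonneg _)

/-- The real `D_p` is below its integer. [folklore] -/
theorem DpR_le : r.DpR ≤ r.toR r.ph'.Dp := by
  rw [DpR, ph'_Dp, sumZ_eq, toR_add, toR_add, toR_add, toR_sum]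
  refine add_le_add (add_le_add (add_le_add (sum_le_sum fun b _ => ?_) le_rfl) le_rfl) le_rfl
  exact toR_mul_le _ _

/-- `Cert.hDp`: `D_p < |Φ|_lo`. [folklore] -/
theorem Dp_lt (hok : r.ph'.ok = true) : r.DpR < r.PhiloR := by
  rw [ph'_ok, Bool.and_eq_true, decide_eq_true_eq] at hok
  exact lt_of_le_of_lt DpR_le (toR_lt hok.2)

/-- `Cert.hρ`: `D_p / (|Φ|_lo − D_p) ≤ ρ`. [folklore] -/
theorem rho_ge (hok : r.ph'.ok = true) : r.DpR / (r.PhiloR - r.DpR) ≤ r.rhoR := by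
  rw [ph'_ok, Bool.and_eq_true, decide_eq_true_eq] at hok
  have hlt : r.ph'.Dp < r.ph'.PhiAbsLo := hok.2
  have hD := DpR_le (r := r)
  have hΦ0 : 0 ≤ r.PhiloR := toR_nonneg PhiAbsLo_nonneg
  have hD'lt : r.toR r.ph'.Dp < r.PhiloR := toR_lt hlt
  -- monotonicity of `x ↦ x / (Φ - x)` below `Φ`
  have h1 : r.DpR / (r.PhiloR - r.DpR) ≤ r.toR r.ph'.Dp / (r.PhiloR - r.toR r.ph'.Dp) := by
    rw [div_le_div_iff₀ (by linarith) (by linarith)]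
    nlinarith
  -- the integer rounding
  have hden : 0 < r.ph'.PhiAbsLo - r.ph'.Dp := by omega
  have h2 : ((r.ph'.Dp * one r.P : ℤ) : ℝ) / ((r.ph'.PhiAbsLo - r.ph'.Dp : ℤ) : ℝ) ≤
      (r.ph'.rho : ℝ) := by
    rw [ph'_rho]; exact div_le_cdiv hden
  have hO : (0 : ℝ) < 2 ^ r.P := by positivity
  have hdenR : (0 : ℝ) < (r.ph'.PhiAbsLo : ℝ) - (r.ph'.Dp : ℝ) := by
    have := (Int.cast_lt (R := ℝ)).mpr hlt; linarith
  have h3 : r.toR r.ph'.Dp / (r.PhiloR - r.toR r.ph'.Dp) =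
      (((r.ph'.Dp * one r.P : ℤ) : ℝ) / ((r.ph'.PhiAbsLo - r.ph'.Dp : ℤ) : ℝ)) / 2 ^ r.P := by
    simp only [toR, PhiloR]
    push_cast [one]
    field_simp
  rw [h3] at h1
  exact h1.trans (div_le_div_of_nonneg_right h2 hO.le)

/-! ### The forcing table -/

/-- The components of `φ`. [folklore] -/
theorem phi'_get (i : Fin 8) : r.phi'.get i = sumZ 9 fun k =>
    cdiv (r.sb'.CF.at i.succ k * r.Eb k) (one r.P) +
      cdiv (cdiv ((one r.P + r.ph'.rho) * r.sb'.APTM.at i.succ k) (one r.P) *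
        (r.FQ.get k + r.DEL k + r.DB.get k)) (one r.P) := by
  rw [phi', Vec.get_mk']

/-- `Cert.hφ`: the forcing bound, given that the radii `FQ + δ + DB` are nonnegative. [folklore] -/
theorem phi_ge (hpos : ∀ b, 0 ≤ r.FQR b + r.δR b + r.DBR b) (i : Fin 8) :
    ∑ b, r.CFR i b * r.EbarR b + (1 + r.rhoR) * ∑ b, r.APmR i b * (r.FQR b + r.δR b + r.DBR b) ≤
      r.phiR i := by
  rw [phiR, phi'_get, sumZ_eq, toR_sum, Finset.mul_sum, ← Finset.sum_add_distrib]
  refine sum_le_sum fun b _ => ?_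
  rw [toR_add]
  refine add_le_add (toR_mul_le _ _) ?_
  have e1 : r.FQR b + r.δR b + r.DBR b = r.toR (r.FQ.get b + r.DEL b + r.DB.get b) := by
    simp [FQR, δR, DBR, toR_add]
  have e2 : 1 + r.rhoR = r.toR (one r.P + r.ph'.rho) := by rw [toR_add, toR_one, rhoR]
  calc (1 + r.rhoR) * (r.APmR i b * (r.FQR b + r.δR b + r.DBR b))
      = ((1 + r.rhoR) * r.APmR i b) * (r.FQR b + r.δR b + r.DBR b) := by ring
    _ ≤ r.toR (cdiv ((one r.P + r.ph'.rho) * r.sb'.APTM.at i.succ b) (one r.P)) *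
          (r.FQR b + r.δR b + r.DBR b) := by
        refine mul_le_mul_of_nonneg_right ?_ (hpos b)
        rw [e2, APmR]
        exact toR_mul_le _ _
    _ ≤ _ := by rw [e1]; exact toR_mul_le _ _

end RowData

end RowCheck

end Summit.NavierStokesRegularity.FluidComputer
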